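import Literature.Topology.FourManifolds.MultiAttachmentEulerModels
import HarnessLib

/-!
# The Euler characteristic of a simultaneous attachment of 4-dimensional 2-handles:
# `χ(B ∪ k two-handles) = χ(B) + k · rank M`

Topic `Literature/Topology/FourManifolds`.  Gompf–Stipsicz, *4-Manifolds and Kirby Calculus*
(1999), §4.2 (p. 111): a handlebody has the homotopy type of a CW complex with one `k`-cell per
`k`-handle, so `χ = Σ (-1)ᵏ #(k-handles)`; in particular attaching `k` two-handles to a compact
`4`-manifold `B` raises the Euler characteristic by `k`.  The tree's `FramedLinkTraceEuler.lean`
proves this for the base `B = D⁴` (the trace of a framed link, `χ = 1 + n`); this file proves it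
**over an arbitrary Hausdorff base `B`** for Kosinski's simultaneous attachment
`HandleAttachingMap.IsMultiAttachment h (𝓡∂ 4) W` (`HandleAttachingMaps.lean`, Kosinski 1993,
VI §6), with coefficients in a finitely generated module `M` over a Noetherian ring `R`
satisfying rank–nullity (the models and the backwards Mayer–Vietoris step are in
`MultiAttachmentEulerModels.lean`):

* `HandleAttachingMap.finRelHomology_coresComplement` — **`χ(B ∖ ⋃ᵢ h̄ᵢ(S)) = χ(B)`** with
  finitely generated homology: the attaching circles are removed one tube at a time,
  `B ∖ ⋃_{j ∈ s} h̄ⱼ(S) = (B ∖ ⋃_{j ∈ insert i s} h̄ⱼ(S)) ∪ h̄ᵢ(T)`, the two open pieces meeting in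
  the punctured tube `h̄ᵢ(T ∖ S)`; both `χ(T)` and `χ(T ∖ S)` vanish, so Mayer–Vietoris read
  backwards keeps `χ` (and finiteness) unchanged;
* `HandleAttachingMap.finRelHomology_range_jA_union_biUnion` — adding the handle pieces
  `jBᵢ(D⁴ ∖ S)` (contractible, `χ = rank M`) one at a time along their gluing regions
  (`≅ T ∖ S`, `χ = 0`): the template
  `DottedCircleDiagram.Realization.finRelHomology_range_glued_union_biUnion` over a general base;
* **`HandleAttachingMap.IsMultiAttachment.finRelHomology_relEuler`** — for a multi-attachment
  `W` of `#ι` two-handles to `B` with `H_•(B; M)` finitely generated and zero from degree `N` on: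
  `H_•(W; M)` is finitely generated, zero from degree `N + #ι + 4` on, and
  `χ(W; M) = χ(B; M) + #ι · rank_R M`.

This is sub-lemma (E-a) of the Euler count `length_eq_bettiNumber_of_isLefschetzHandlebodyOver`
(`SteinBisectionAchiralWordModel.lean`; Gompf–Stipsicz 1999, §8.2: `χ(X(P; w)) = 1 - b₁(P) + |w|`).
Everything is proved; there are no definitions and no named facts.

## References

* R. E. Gompf, A. I. Stipsicz, *4-Manifolds and Kirby Calculus*, GSM 20 (1999), §4.2 p. 111.
  [GompfStipsiczGSM1999]
* A. A. Kosinski, *Differential Manifolds* (1993), VI §6. [Kosinski1993]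
* A. Hatcher, *Algebraic Topology* (2002), §2.2 pp. 149–150 (Mayer–Vietoris), Thm. 2.44.
  [HatcherAT2002]
-/

open scoped Manifold ContDiff Topology
open Set Function Metric Topology CategoryTheory Limits

noncomputable section

namespace Literature.Topology.FourManifolds

open Literature.AlgebraicTopology.SingularHomology Literature.AlgebraicTopology.Homotopy
open Literature.AlgebraicTopology.FundamentalGroup.VanKampen

universe u v

/-! ### §1 Removing the attaching circles from the base does not change `χ` -/

namespace HandleAttachingMap

section Cores

variable (R : Type v) [CommRing R] [IsNoetherianRing R] [HasRankNullity.{max u v} R] (M : Type v)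
  [AddCommGroup M] [Module R M] [Module.Finite R M]
  {B : Type u} [TopologicalSpace B] [T2Space B] [ChartedSpace (EuclideanHalfSpace 4) B]

omit [T2Space B] in
/-- The image `h̄(T)` of the tube under an attaching map: finitely generated homology with
coefficients in `M`, zero from degree `3` on, `χ = 0` (`h̄` is an embedding).
[cite: Kosinski1993, VI §6] -/
theorem finRelHomology_range_toFun (f : HandleAttachingMap 3 2 B) :
    FinRelHomology R M ↥(range f.toFun) ∅ 3 ∧ relEuler R M ↥(range f.toFun) ∅ = 0 :=
  finRelHomology_of_homeomorph_handleTube₄ R M f.isSmoothEmbedding.isEmbedding.toHomeomorph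

omit [T2Space B] in
/-- The image `h̄(T ∖ S)` of the punctured tube under an attaching map: finitely generated
homology with coefficients in `M`, zero from degree `3` on, `χ = 0`. [cite: Kosinski1993, VI §6] -/
theorem finRelHomology_image_toFun_lamSq_ne_one (f : HandleAttachingMap 3 2 B) :
    FinRelHomology R M ↥(f.toFun '' {y : ↥(handleTube 3 2) | lamSq 2 y.1.1 ≠ 1}) ∅ 3 ∧
      relEuler R M ↥(f.toFun '' {y : ↥(handleTube 3 2) | lamSq 2 y.1.1 ≠ 1}) ∅ = 0 :=
  finRelHomology_of_homeomorph_handleTube₄_lamSq_ne_one R M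
    ((f.isSmoothEmbedding.isEmbedding.comp IsEmbedding.subtypeVal).toHomeomorph.trans
      (Homeomorph.setCongr (by rw [range_comp, Subtype.range_coe])))

variable {ι : Type} [Fintype ι] {h : ι → HandleAttachingMap 3 2 B}

omit [T2Space B] in
/-- The attaching sphere lies in the image of the attaching map. [folklore] -/
theorem core_subset_range (f : HandleAttachingMap 3 2 B) : f.core ⊆ range f.toFun :=
  image_subset_range _ _

omit [Fintype ι] in
/-- `B` minus finitely many attaching circles is open. [folklore] -/
theorem isOpen_compl_biUnion_core (s : Finset ι) : IsOpen (⋃ j ∈ s, (h j).core)ᶜ :=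
  (isClosed_biUnion_finset fun j _ => (h j).isClosed_core).isOpen_compl

omit [T2Space B] [Fintype ι] in
/-- Putting the tube `h̄ᵢ(T)` back: `(B ∖ ⋃_{j ∈ insert i s} h̄ⱼ(S)) ∪ h̄ᵢ(T) = B ∖ ⋃_{j ∈ s} h̄ⱼ(S)`
for `i ∉ s` (the tubes have pairwise disjoint images). [cite: Kosinski1993, VI §6] -/
theorem compl_biUnion_core_insert_union_range
    [DecidableEq ι] (hdisj : Pairwise fun i j => Disjoint (range (h i).toFun) (range (h j).toFun))
    {s : Finset ι} {i : ι} (hi : i ∉ s) :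
    (⋃ j ∈ insert i s, (h j).core)ᶜ ∪ range (h i).toFun = (⋃ j ∈ s, (h j).core)ᶜ := by
  ext b
  constructor
  · rintro (hb | ⟨y, rfl⟩)
    · intro hb'
      obtain ⟨j, hj, hbj⟩ := mem_iUnion₂.1 hb'
      exact hb (mem_iUnion₂.2 ⟨j, Finset.mem_insert_of_mem hj, hbj⟩)
    · intro hb'
      obtain ⟨j, hj, hbj⟩ := mem_iUnion₂.1 hb'
      have hne : j ≠ i := fun e => hi (e ▸ hj)
      exact Set.disjoint_left.1 (hdisj hne) ((h j).core_subset_range hbj) (mem_range_self y)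
  · intro hb
    by_cases hbi : b ∈ (h i).core
    · exact Or.inr ((h i).core_subset_range hbi)
    · refine Or.inl fun hb' => ?_
      obtain ⟨j, hj, hbj⟩ := mem_iUnion₂.1 hb'
      rcases Finset.mem_insert.1 hj with rfl | hj'
      · exact hbi hbj
      · exact hb (mem_iUnion₂.2 ⟨j, hj', hbj⟩)

omit [T2Space B] [Fintype ι] in
/-- The tube `h̄ᵢ(T)` meets `B ∖ ⋃_{j ∈ insert i s} h̄ⱼ(S)` in the punctured tube `h̄ᵢ(T ∖ S)`.
[cite: Kosinski1993, VI §6] -/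
theorem compl_biUnion_core_insert_inter_range [DecidableEq ι]
    (hdisj : Pairwise fun i j => Disjoint (range (h i).toFun) (range (h j).toFun))
    (s : Finset ι) (i : ι) :
    (⋃ j ∈ insert i s, (h j).core)ᶜ ∩ range (h i).toFun =
      (h i).toFun '' {y : ↥(handleTube 3 2) | lamSq 2 y.1.1 ≠ 1} := by
  ext b
  constructor
  · rintro ⟨hb, y, rfl⟩
    refine ⟨y, fun hy => hb ?_, rfl⟩
    exact mem_biUnion (Finset.mem_insert_self i s) (((h i).mem_core_iff).2 ⟨y, hy, rfl⟩)
  · rintro ⟨y, hy, rfl⟩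
    refine ⟨fun hb => ?_, mem_range_self y⟩
    have hc := apply_notMem_iUnion_core hdisj i y hy
    obtain ⟨j, -, hbj⟩ := mem_iUnion₂.1 hb
    exact hc (mem_iUnion.2 ⟨j, hbj⟩)

omit [Fintype ι] in
/-- **Removing the attaching circles one at a time**: for every finite set `s` of handles,
`B ∖ ⋃_{j ∈ s} h̄ⱼ(S)` has finitely generated homology with coefficients in `M`, zero from degree
`max N 3` on, and the Euler characteristic of `B` (Mayer–Vietoris read backwards,
`finRelHomology_left_of_isOpen_union_of_relEuler_eq`: the tube `h̄ᵢ(T)` and its trace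
`h̄ᵢ(T ∖ S)` both have `χ = 0`). [cite: GompfStipsiczGSM1999, §4.2 p. 111]
[cite: HatcherAT2002, §2.2 pp. 149–150] -/
theorem finRelHomology_compl_biUnion_core
    (hdisj : Pairwise fun i j => Disjoint (range (h i).toFun) (range (h j).toFun))
    {N : ℕ} (hB : FinRelHomology R M B ∅ N) (s : Finset ι) :
    FinRelHomology R M ↥(⋃ j ∈ s, (h j).core)ᶜ ∅ (max N 3) ∧
      relEuler R M ↥(⋃ j ∈ s, (h j).core)ᶜ ∅ = relEuler R M B ∅ := by
  classical
  induction s using Finset.induction_on with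
  | empty =>
    have hset : (⋃ j ∈ (∅ : Finset ι), (h j).core)ᶜ = (univ : Set B) := by simp
    let e : B ≃ₜ ↥(⋃ j ∈ (∅ : Finset ι), (h j).core)ᶜ :=
      (Homeomorph.Set.univ B).symm.trans (Homeomorph.setCongr hset.symm)
    exact ⟨(hB.of_homeomorph e (mapsTo_empty _ _) (mapsTo_empty _ _)).mono (le_max_left _ _),
      (relEuler_eq_of_homeomorph e (mapsTo_empty _ _) (mapsTo_empty _ _)).symm⟩
  | insert i s hi ih =>
    obtain ⟨ihf, ihχ⟩ := ih
    set A : Set B := (⋃ j ∈ insert i s, (h j).core)ᶜ with hA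
    set T : Set B := range (h i).toFun with hT
    have hAo : IsOpen A := isOpen_compl_biUnion_core (insert i s)
    have hTo : IsOpen T := (h i).isOpen_range
    have hAT : A ∪ T = (⋃ j ∈ s, (h j).core)ᶜ := compl_biUnion_core_insert_union_range hdisj hi
    have hAT' : A ∩ T = (h i).toFun '' {y : ↥(handleTube 3 2) | lamSq 2 y.1.1 ≠ 1} :=
      compl_biUnion_core_insert_inter_range hdisj s i
    -- the inputs of the backwards Mayer–Vietoris step, all with the bound `max N 3`
    let eU : ↥(⋃ j ∈ s, (h j).core)ᶜ ≃ₜ ↥(A ∪ T) := Homeomorph.setCongr hAT.symm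
    have hU : FinRelHomology R M ↥(A ∪ T) ∅ (max N 3) :=
      ihf.of_homeomorph eU (mapsTo_empty _ _) (mapsTo_empty _ _)
    obtain ⟨hfT, hχT⟩ := (h i).finRelHomology_range_toFun R M
    obtain ⟨hfI, hχI⟩ := (h i).finRelHomology_image_toFun_lamSq_ne_one R M
    let eI : ↥((h i).toFun '' {y : ↥(handleTube 3 2) | lamSq 2 y.1.1 ≠ 1}) ≃ₜ ↥(A ∩ T) :=
      Homeomorph.setCongr hAT'.symm
    have hfAT : FinRelHomology R M ↥(A ∩ T) ∅ (max N 3) :=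
      (hfI.of_homeomorph eI (mapsTo_empty _ _) (mapsTo_empty _ _)).mono (le_max_right _ _)
    have hχAT : relEuler R M ↥(A ∩ T) ∅ = relEuler R M ↥T ∅ := by
      rw [← relEuler_eq_of_homeomorph (R := R) (M := M) eI (mapsTo_empty _ _) (mapsTo_empty _ _),
        hχI, hχT]
    obtain ⟨hfA, hχA⟩ := finRelHomology_left_of_isOpen_union_of_relEuler_eq R M hAo hTo hU
      (hfT.mono (le_max_right _ _)) hfAT hχAT
    refine ⟨hfA, ?_⟩
    rw [hχA, ← relEuler_eq_of_homeomorph (R := R) (M := M) eU (mapsTo_empty _ _) (mapsTo_empty _ _),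
      ihχ]

/-- **`χ(B ∖ ⋃ᵢ h̄ᵢ(S)) = χ(B)`**: for attaching maps of `2`-handles with pairwise disjoint images
on a Hausdorff `4`-manifold `B` whose homology (coefficients `M`) is finitely generated and zero
from degree `N` on, the base piece `B ∖ ⋃ᵢ h̄ᵢ(S)` of a multi-attachment has finitely generated
homology, zero from degree `max N 3` on, and the Euler characteristic of `B`.
[cite: GompfStipsiczGSM1999, §4.2 p. 111] [cite: HatcherAT2002, §2.2 pp. 149–150] -/
theorem finRelHomology_coresComplement
    (hdisj : Pairwise fun i j => Disjoint (range (h i).toFun) (range (h j).toFun))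
    {N : ℕ} (hB : FinRelHomology R M B ∅ N) :
    FinRelHomology R M ↥(coresComplement h) ∅ (max N 3) ∧
      relEuler R M ↥(coresComplement h) ∅ = relEuler R M B ∅ := by
  classical
  obtain ⟨hf, hχ⟩ := finRelHomology_compl_biUnion_core R M hdisj hB Finset.univ
  have hset : (⋃ j ∈ (Finset.univ : Finset ι), (h j).core)ᶜ =
      ((coresComplement h : TopologicalSpace.Opens B) : Set B) := by
    show (⋃ j ∈ (Finset.univ : Finset ι), (h j).core)ᶜ = (⋃ j, (h j).core)ᶜ
    simp
  let e : ↥(⋃ j ∈ (Finset.univ : Finset ι), (h j).core)ᶜ ≃ₜ ↥(coresComplement h) :=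
    Homeomorph.setCongr hset
  exact ⟨hf.of_homeomorph e (mapsTo_empty _ _) (mapsTo_empty _ _),
    (relEuler_eq_of_homeomorph e (mapsTo_empty _ _) (mapsTo_empty _ _)).symm.trans hχ⟩

end Cores

/-! ### §2 The handle pieces, one at a time -/

section Handles

variable (R : Type v) [CommRing R] [IsNoetherianRing R] [HasRankNullity.{max u v} R] (M : Type v)
  [AddCommGroup M] [Module R M] [Module.Finite R M]
  {B : Type u} [TopologicalSpace B] [T2Space B] [ChartedSpace (EuclideanHalfSpace 4) B]
  {ι : Type} [Fintype ι] {h : ι → HandleAttachingMap 3 2 B}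
  {W : Type u} [TopologicalSpace W]

/-- **Adding the handle pieces one at a time** (the template
`DottedCircleDiagram.Realization.finRelHomology_range_glued_union_biUnion` over a general base):
given the pieces `jA(B ∖ ⋃ h̄ᵢ(S))` and `jBᵢ(D⁴ ∖ S)` of a multi-attachment, for every finite
set `s` of handles the open set `jA(B ∖ ⋃ h̄ᵢ(S)) ∪ ⋃_{j ∈ s} jBⱼ(D⁴ ∖ S)` has finitely generated
homology with coefficients in `M`, zero from degree `max N 3 + #s` on, and Euler characteristic
`χ(B) + #s · rank M` (each handle piece is contractible and meets the previous union in its gluing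
region `≅ T ∖ S`, `χ = 0`). [cite: GompfStipsiczGSM1999, §4.2 p. 111]
[cite: HatcherAT2002, §2.2 pp. 149–150] -/
theorem finRelHomology_range_jA_union_biUnion
    (hdisj : Pairwise fun i j => Disjoint (range (h i).toFun) (range (h j).toFun))
    {jA : ↥(coresComplement h) → W} {jB : ι → ↥(beltPiece 3 2) → W}
    (hjA : IsEmbedding jA) (hjAo : IsOpen (range jA))
    (hjB : ∀ i, IsEmbedding (jB i) ∧ IsOpen (range (jB i)))
    (hglue : ∀ i a b, jA a = jB i b ↔ (h i).glueRel (a : B) b.1)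
    (hdisjB : Pairwise fun i j => Disjoint (range (jB i)) (range (jB j)))
    {N : ℕ} (hB : FinRelHomology R M B ∅ N) (s : Finset ι) :
    FinRelHomology R M ↥(range jA ∪ ⋃ j ∈ s, range (jB j)) ∅ (max N 3 + s.card) ∧
      relEuler R M ↥(range jA ∪ ⋃ j ∈ s, range (jB j)) ∅ =
        relEuler R M B ∅ + s.card * Module.finrank R M := by
  classical
  -- the base piece
  obtain ⟨hfC, hχC⟩ := finRelHomology_coresComplement R M hdisj hB
  let eA : ↥(coresComplement h) ≃ₜ ↥(range jA) := hjA.toHomeomorph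
  have hfA₀ : FinRelHomology R M ↥(range jA) ∅ (max N 3) :=
    hfC.of_homeomorph eA (mapsTo_empty _ _) (mapsTo_empty _ _)
  have hχA₀ : relEuler R M ↥(range jA) ∅ = relEuler R M B ∅ :=
    (relEuler_eq_of_homeomorph eA (mapsTo_empty _ _) (mapsTo_empty _ _)).symm.trans hχC
  -- the handle pieces
  have hP : ∀ i, FinRelHomology R M ↥(range (jB i)) ∅ 1 ∧
      relEuler R M ↥(range (jB i)) ∅ = Module.finrank R M := fun i =>
    finRelHomology_of_homeomorph_beltPiece₄ R M (hjB i).1.toHomeomorph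
  -- the gluing regions
  have hI : ∀ i, FinRelHomology R M ↥(range jA ∩ range (jB i)) ∅ 3 ∧
      relEuler R M ↥(range jA ∩ range (jB i)) ∅ = 0 := fun i => by
    have heq := IsMultiAttachment.range_jA_inter_range_jB hdisj hglue i
    exact finRelHomology_of_homeomorph_beltPiece₄_lamSq_ne_zero R M
      (((hjB i).1.comp IsEmbedding.subtypeVal).toHomeomorph.trans
        (Homeomorph.setCongr (by rw [heq, range_comp, Subtype.range_coe])))
  induction s using Finset.induction_on with
  | empty =>
    have hset : range jA ∪ ⋃ j ∈ (∅ : Finset ι), range (jB j) = range jA := by simp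
    let e : ↥(range jA) ≃ₜ ↥(range jA ∪ ⋃ j ∈ (∅ : Finset ι), range (jB j)) :=
      Homeomorph.setCongr hset.symm
    refine ⟨(hfA₀.of_homeomorph e (mapsTo_empty _ _) (mapsTo_empty _ _)).mono (by simp), ?_⟩
    rw [← relEuler_eq_of_homeomorph (R := R) (M := M) e (mapsTo_empty _ _) (mapsTo_empty _ _),
      hχA₀]
    simp
  | insert i s hi ih =>
    obtain ⟨ihf, ihχ⟩ := ih
    set A : Set W := range jA ∪ ⋃ j ∈ s, range (jB j) with hA
    set Bi : Set W := range (jB i) with hBi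
    have hAo : IsOpen A := isOpen_union_biUnion hjAo (fun j => (hjB j).2) s
    have hBo : IsOpen Bi := (hjB i).2
    have hAB : A ∩ Bi = range jA ∩ range (jB i) := union_biUnion_inter_eq hdisjB hi
    -- the three inputs of Mayer–Vietoris, all with the bound `max N 3 + #s`
    have hfA : FinRelHomology R M ↥A ∅ (max N 3 + s.card) := ihf
    have hfB : FinRelHomology R M ↥Bi ∅ (max N 3 + s.card) := (hP i).1.mono (by omega)
    obtain ⟨hfI, hχI⟩ := hI i
    let eI : ↥(range jA ∩ range (jB i)) ≃ₜ ↥(A ∩ Bi) := Homeomorph.setCongr hAB.symm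
    have hfAB : FinRelHomology R M ↥(A ∩ Bi) ∅ (max N 3 + s.card) :=
      (hfI.of_homeomorph eI (mapsTo_empty _ _) (mapsTo_empty _ _)).mono (by omega)
    have hχAB : relEuler R M ↥(A ∩ Bi) ∅ = 0 := by
      rw [← relEuler_eq_of_homeomorph (R := R) (M := M) eI (mapsTo_empty _ _) (mapsTo_empty _ _),
        hχI]
    obtain ⟨hf, hχ⟩ := finRelHomology_union_of_isOpen R M hAo hBo hfA hfB hfAB
    -- `A ∪ Bi` is the union over `insert i s`
    have hset : A ∪ Bi = range jA ∪ ⋃ j ∈ insert i s, range (jB j) := by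
      rw [Finset.set_biUnion_insert, hA, hBi, union_assoc, union_comm (⋃ j ∈ s, range (jB j))]
    let e : ↥(A ∪ Bi) ≃ₜ ↥(range jA ∪ ⋃ j ∈ insert i s, range (jB j)) :=
      Homeomorph.setCongr hset
    refine ⟨?_, ?_⟩
    · rw [Finset.card_insert_of_notMem hi, ← add_assoc]
      exact hf.of_homeomorph e (mapsTo_empty _ _) (mapsTo_empty _ _)
    · rw [← relEuler_eq_of_homeomorph (R := R) (M := M) e (mapsTo_empty _ _) (mapsTo_empty _ _),
        Finset.card_insert_of_notMem hi]
      have hχB := (hP i).2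
      push_cast
      linarith

end Handles

/-! ### §3 The Euler characteristic of a simultaneous 2-handle attachment -/

/-- **`χ(B ∪ k two-handles; M) = χ(B; M) + k · rank M`, with finitely generated homology**
(Gompf–Stipsicz 1999, §4.2 p. 111: a handlebody has the homotopy type of a CW complex with one
`k`-cell per `k`-handle, `χ = Σ (-1)ᵏ #(k-handles)`; here over an arbitrary base).  For a
simultaneous Kosinski attachment `W` of `#ι` four-dimensional `2`-handles to a Hausdorff
`4`-manifold `B` along attaching maps `h` (`HandleAttachingMap.IsMultiAttachment`), if
`H_•(B; M)` is finitely generated and zero from degree `N` on, then `H_•(W; M)` is finitely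
generated, zero from degree `N + #ι + 4` on, and `χ(W; M) = χ(B; M) + #ι · rank_R M`
(coefficients: `M` finitely generated over a Noetherian ring `R` with rank–nullity in the universe
of the homology groups, as in `finRelHomology_union_of_isOpen`; e.g. `R = M = ℤ` or a field).
Proof: Mayer–Vietoris on Kosinski's open cover of `W` — backwards on the base
(`χ(B ∖ ⋃ h̄ᵢ(S)) = χ(B)`, `finRelHomology_coresComplement`), forwards over the handle pieces
(`finRelHomology_range_jA_union_biUnion`).  This is sub-lemma (E-a) of the Euler count
`length_eq_bettiNumber_of_isLefschetzHandlebodyOver` (`SteinBisectionAchiralWordModel.lean`).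
[cite: GompfStipsiczGSM1999, §4.2 p. 111] [cite: Kosinski1993, VI §6] -/
theorem IsMultiAttachment.finRelHomology_relEuler
    (R : Type v) [CommRing R] [IsNoetherianRing R] [HasRankNullity.{max u v} R] (M : Type v)
    [AddCommGroup M] [Module R M] [Module.Finite R M]
    {B : Type u} [TopologicalSpace B] [T2Space B] [ChartedSpace (EuclideanHalfSpace 4) B]
    {ι : Type} [Fintype ι] {h : ι → HandleAttachingMap 3 2 B}
    {W : Type u} [TopologicalSpace W] [ChartedSpace (EuclideanHalfSpace 4) W]
    (hW : HandleAttachingMap.IsMultiAttachment h (𝓡∂ 4) W) {N : ℕ}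
    (hB : FinRelHomology R M B ∅ N) :
    FinRelHomology R M W ∅ (N + Fintype.card ι + 4) ∧
      relEuler R M W ∅ = relEuler R M B ∅ + Fintype.card ι * Module.finrank R M := by
  classical
  obtain ⟨hdisj, jA, jB, hjA, hjAo, hjB, hcov, hglue, hdisjB⟩ := hW
  obtain ⟨hf, hχ⟩ := finRelHomology_range_jA_union_biUnion R M hdisj hjA.isEmbedding hjAo
    (fun i => ⟨(hjB i).1.isEmbedding, (hjB i).2⟩) hglue hdisjB hB Finset.univ
  have hset : range jA ∪ ⋃ j ∈ (Finset.univ : Finset ι), range (jB j) = univ := by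
    rw [← hcov]
    congr 1
    ext p
    simp
  let e : ↥(range jA ∪ ⋃ j ∈ (Finset.univ : Finset ι), range (jB j)) ≃ₜ W :=
    (Homeomorph.setCongr hset).trans (Homeomorph.Set.univ W)
  refine ⟨?_, ?_⟩
  · refine (hf.of_homeomorph e (mapsTo_empty _ _) (mapsTo_empty _ _)).mono ?_
    rw [Finset.card_univ]
    omega
  · rw [← relEuler_eq_of_homeomorph (R := R) (M := M) e (mapsTo_empty _ _) (mapsTo_empty _ _), hχ,
      Finset.card_univ]

end HandleAttachingMap

end Literature.Topology.FourManifolds
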